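import Literature.MathematicalPhysics.QuantumFieldTheory.Balaban1983to89.Node00.Record13LettersOfThm1CCM
import Literature.MathematicalPhysics.QuantumFieldTheory.Balaban1983to89.Node00.Record12BgRowCoClassGaugeR
import Literature.MathematicalPhysics.QuantumFieldTheory.Balaban1983to89.Node00.Record13SepCoPH
import Literature.MathematicalPhysics.QuantumFieldTheory.Balaban1983to89.Node00.Record12BgRowCoClassGaugeRGuardedBRow
import Literature.MathematicalPhysics.QuantumFieldTheory.Balaban1983to89.Node00.LargeFieldBackgroundCoPOfRecordB

/-!
# NODE 00 (YM-PLAN Track A) — STAGE 13: THE K0 BODIES (⁵ `SepCoP`, ⁶ `SepCoPR`, ⁷ `SepCoPH`) FOR `F` AT `N = 2` AT THE COLLARED WITNESS `θ₁₅ᶜᶜᴹ(j)` FROM THE GUARDED (8)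
# `VariationalThm1RegSepCoP7MGB … (floorGuard F c) (lamDatum F) (dataSmall7PTopOf F N) …`, THE FLOOR-GUARDED (9)-STEP `Gauge9RegSepTopStepGB … (L^j) (floorGuard F c) (lamDatum F) (dataSmall7PTopOf F N) …`
# (`c ≤ L^j`), THE β-BOX AT `θ₁₅ᶜᶜᴹ(j)` AND THE SIGNS — UNDER `j + 1 ≤ F.m` (plan g75 V14 stub 3 `K0ROfStepTokensRAt` for `4 ≤ F.m`, at `M = c = L³`) — STAGE-2 EDITION AT PRINT's (2.3) DATUM

Cell `pub-ymgap`, seat `pub-ymgap-dag-n21-c` (g11) — pens (γ)+(β) of dag-lead WORDS-144∕145; FILE B of the sequence A1∕A2 (`Record13NumericsOfThm1CCM` ∕ `Record13LettersOfThm1CCM`: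
the collared member and its letters) → B′ (`Record12BgRowCoClassGaugeR`: the R-port of the gauge sentence and FILE 21 §2's lift with `hc`) → B.  NEW leaf, theorems only;
node00-def-K0a's FILE 16a (`exists_k0SepCoP_of_bgSepCoP_theta13LiveOfNumerics`, `provisos₁₃SepCoP_theta13LiveOfNumerics_of_bgSepCoP`), FILE 18 (`exists_k0SepCoPR_of_exists_k0SepCoP`),
node00-def-T's v1.7 door (`Stage13HParams.ofHistoryBlind`, `Provisos₁₃SepCoPR.ofHistoryBlind`, `ZrUnity.ofHistoryBlind`) and S1b-1's `Gauge9RegSepTopStepGB` (`TorusCoverGaugeTokensGuardedB`) CONSUMED BY NAME.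
`--supports stmt-QuantumFields-20541`.  [15] = [Balaban1985Variational]; [6] = [Balaban1985RegularSpaces]; [III] = [Balaban1988Convergent]; [I] = [Balaban1987RG1]; [IV] = [Balaban1989LargeFieldI].

STAGE-2 RE-KEY (node00-def-T g25, S1d CHAIN B1 by node00-def-K0a's assignment ∕ recipe, director-ym №346 ∕ №352): (E1) Stage-2 coherence re-key to print's (2.3) datum (FLAG №16 ∕ LOCATE-HSEAM
5d3298b8d191f169); the (b)-keyed text survives in git history.  Every displayed (8) ∕ (9) ∕ step token of this file is now the GUARDED `(bd, Dat)` ᴮ token at the floor guard `floorGuard F c`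
(`c ≤ ν.M₁`), print's bond datum `lamDatum F` ([14] (2.3): `lamBondsSeq Ω k`) and the (7)-data predicate of record `dataSmall7PTopOf F N`: (8) `VariationalThm1RegSepCoP7MGB F N (floorGuard F c)
(lamDatum F) (dataSmall7PTopOf F N) B₃ a₀ a₁` (`Record12BgRowCoClassCPMFloorB`), (9) `VariationalThm1GaugeRegSepCoP7MGB F N (F.L ^ j) (floorGuard F c) (lamDatum F) (dataSmall7PTopOf F N) B₃ B₃' a₀ a₁`
(`Record12BgRowCoClassGaugeRGuardedB`; from the step token by `variationalThm1GaugeRegSepCoP7MGB_of_gauge9TopStepGB`), step `Gauge9RegSepTopStepGB F N suppDom (F.L ^ j) (floorGuard F c) (lamDatum F)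
(dataSmall7PTopOf F N) B₃ B₃' a₀ a₁` (`TorusCoverGaugeTokensGuardedB`).  At level `n+1` the carrier `UbgOfRecord₁₃CoP … (n+1)` IS node00-def-R's `UbgMSCoPOfRecordB …` at print's datum
(`LargeFieldBackgroundCoPOfRecordB`, `UbgOfRecord₁₃CoP_succ` after the Stage-2 seam edit of `Record13CoP`) and the row is `Record12BgRowCoClassGaugeRGuardedBRow` §3
`Stage13Params.bgAtDatumBg_of_thm1RegSepCoP7MGB_of_thm1GaugeGB` with `Ubg := UbgMSCoPOfRecordB …`, `hbg := ubgMSCoPOfRecordB_dichotomy …` inlined and the guard `c ≤ M₁ = L^j` discharged by `hc`.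
Declaration NAMES are unchanged (the `R` ∕ `7M` in them is historical); the prose «(8) ∕ the R gauge sentence ∕ the R step fact» below denotes these ᴮ tokens.  Re-keying bookkeeping only —
nothing of Bałaban asserted. [14] = [Balaban1984PropagatorsII].

WHAT THIS FILE PROVES (theorems only; 0 `def`).
§1 ★★★ `bgSepCoPAt_theta13OfThm1CCM_of_thm1GaugeR (hjm : j + 1 ≤ F.m) (signs) (h15) (hc : c ≤ F.L ^ j) (h15G : VariationalThm1GaugeRegSepCoP7MGB F N (F.L ^ j) (floorGuard F c) (lamDatum F) (dataSmall7PTopOf F N) B₃ B₃' a₀ a₁) (hmono) (hcompRev)`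
   ⊢ 16a's (7)-guarded row-P11 clause at `θ₁₅ᶜᶜᴹ(j)` (level `n+1`: `UbgOfRecord₁₃CoP_succ` + `Record12BgRowCoClassGaugeRGuardedBRow` §3 at `UbgMSCoPOfRecordB` with A2's letters and `M₁ = L^j ≥ c`; level `0` vacuous); ★★ `provisos₁₃SepCoP_theta13OfThm1CCM_of_thm1GaugeR`
   (pins `⟨j, rfl⟩`, `dvd_refl`).
§2 CLOSERS (`N = 2`): ★★★★★ `exists_k0SepCoP_of_thm1RegSepCoP7M_of_thm1GaugeR (hjm) (signs) (h15) (hc) (h15G) (hmono) (hcompRev)`, ★★★★★★ `…_of_betaBox (hb hlow hup hβ')` (history clauses by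
   A2 §5), ★★★★★★★ `exists_k0SepCoP_of_thm1RegSepCoP7M_of_gauge9TopStepR_of_betaBox (h9 : Gauge9RegSepTopStepGB F 2 suppDom (F.L ^ j) (floorGuard F c) (lamDatum F) (dataSmall7PTopOf F 2) B₃ B₃' a₀ a₁)` (`Record12BgRowCoClassGaugeRGuardedB` §3: minimal ⇒ critical on the `lamDatum`-fibre);
   the ⁶ images `exists_k0SepCoPR_…` (FILE 18's cured lift) and the ⁷ images `exists_k0SepCoPH_…` (the history-blind door; generic lift `exists_k0SepCoPH_of_exists_k0SepCoPR`);
   and the V14-facing instance ★ `exists_k0SepCoPR_of_thm1RegSepCoP7M_of_gauge9TopStepR_of_betaBox_cube (hm : 4 ≤ F.m)` at `j = 3`, `c = (11·4 + 3·F.L)·F.L` (stub 3's floor), `M = F.L ^ 3`.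
   What remains displayed: (8) `VariationalThm1RegSepCoP7MGB F 2 (floorGuard F c) (lamDatum F) (dataSmall7PTopOf F 2) B₃ a₀ a₁` (⟸ [15] Prop. 8's guarded top step over `(bd, Dat)`,
   `variationalThm1RegSepCoP7MGB_of_prop8RegSepTopStepGB_of_zero`), the ᴮ step fact (⟸ `Prop8RegSepTopStepGB` ∧ `Gauge152OfClassTopStepR` by `gauge9GB_of_prop8TopStepGB_of_gauge152R`;
   [6] Prop. 6 at NODE 00's member, `gauge152R_of_prop6`), the β-box of `betaOfRecord₁₃ F 2 θ₁₅ᶜᶜᴹ(j)`, the signs, AND `j + 1 ≤ F.m` (plan g75 LOCATED (δ):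
   at this member the non-wrapping binder is EQUIVALENT to it, A2 `hsN_theta13OfThm1CCM_iff`; families with `F.m ≤ 3` have no witness on this road — director's ruling pending).

HONEST FRAMING.  Compositions of tree theorems; CONDITIONAL on the displayed named facts (`Prop`s with parameters, NEVER asserted) and on the β-box; nothing of Bałaban asserted or
discharged; K0⁷ NOT closed here; counts unmoved (typed 28∕28 · discharged 5∕27); one finite 𝕋⁴ programme at fixed ε — NOT continuum ∕ OS ∕ mass gap ∕ Clay.  No `sorry`, `axiom`,
`def`, `instance`, `notation`.
-/

noncomputable section

open MeasureTheory
open scoped Matrix.Norms.L2Operator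

namespace Literature.MathematicalPhysics.QuantumFieldTheory.Balaban1983to89.Node00

open T4Continuum B14.Eq218Concrete B15DeterminingSets FlowStep FlowStepRuns B12RegularSpaces111 B14RegularSpaces234

/-! ## §1. ★★★ At `θ₁₅ᶜᶜᴹ(j)`: the (7)-guarded separated row P11 at the Co carrier from (8), the R gauge sentence and the two history clauses -/

section AtWitnessGaugeR

variable {F : T4Family} {N : ℕ} [NeZero N] {j c : ℕ} {ε₀ ε₂₉ B₃ B₃' a₀ a₁ : ℝ}

/-- **★★★ THE (7)-GUARDED SEPARATED ROW P11 AT THE Co CARRIER AT `θ₁₅ᶜᶜᴹ(j)`, PER PARTITION-COMPATIBLE RUN, FROM (8) `VariationalThm1RegSepCoP7MGB F N (floorGuard F c) (lamDatum F) (dataSmall7PTopOf F N) B₃ a₀ a₁`, THE R GAUGE SENTENCE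
`VariationalThm1GaugeRegSepCoP7MGB F N (F.L ^ j) (floorGuard F c) (lamDatum F) (dataSmall7PTopOf F N) B₃ B₃' a₀ a₁` AT A FLOOR `c ≤ F.L ^ j = M₁`, AND THE TWO HISTORY CLAUSES**, under `j + 1 ≤ F.m` (the non-wrapping binder, A2 `hsN_theta13OfThm1CCM`):
at level `n+1` the carrier IS def-R's collar-class minimiser at print's (2.3) datum `UbgMSCoPOfRecordB` (`UbgOfRecord₁₃CoP_succ`, Stage 2) and `Record12BgRowCoClassGaugeRGuardedBRow` §3 applies
(`Ubg := UbgMSCoPOfRecordB`, `hbg := ubgMSCoPOfRecordB_dichotomy`, guard `floorGuard F c` from `hc`) with A2's letters (`hnum_`∕`εreg_le_`∕`hcomp_…_of_monotone`∕`hBα_`∕`htI_`∕`htMS_`∕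
`hC1_`∕`hsN_theta13OfThm1CCM`); level `0` is vacuous.  16a's hypothesis `hbgSepCoP` VERBATIM.  CONDITIONAL; nothing of Bałaban asserted. [cite: Balaban1985Variational, (6)–(7) p.278, Thm 1 (8)–(9) p.279, (144)–(152) pp.300–301, Prop. 8 p.304; Balaban1985RegularSpaces, (1.3)–(1.9) p.77, Prop. 6 p.99; Balaban1988Convergent, Thm 1 p.262, (2.4)–(2.8) pp.255–256, (2.12)–(2.13) p.256, (2.27)–(2.28) p.259, (2.34)–(2.41) p.261, (3.16)–(3.22) pp.268–269; Balaban1987RG1, (0.1) p.251, (1.11)–(1.12) p.262; Balaban1989LargeFieldI, (0.3)–(0.4) p.176] -/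
theorem bgSepCoPAt_theta13OfThm1CCM_of_thm1GaugeR (hjm : j + 1 ≤ F.m) (hε : 0 < ε₀) (hε' : 0 < ε₂₉) (hB : 0 ≤ B₃) (hB' : 0 ≤ B₃') (ha₀ : 0 < a₀) (ha₁ : 0 < a₁)
    (h15 : VariationalThm1RegSepCoP7MGB F N (floorGuard F c) (lamDatum F) (dataSmall7PTopOf F N) B₃ a₀ a₁) (hc : c ≤ F.L ^ j) (h15G : VariationalThm1GaugeRegSepCoP7MGB F N (F.L ^ j) (floorGuard F c) (lamDatum F) (dataSmall7PTopOf F N) B₃ B₃' a₀ a₁)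
    (hmono : ∀ (p : B12.RunParams) (n : ℕ), n ≤ p.K → Step.InInterval (theta13OfThm1CCM F N j ε₀ ε₂₉ B₃ B₃' a₀ a₁).γ n (gOfRecord₁₃ F N (theta13OfThm1CCM F N j ε₀ ε₂₉ B₃ B₃' a₀ a₁) p) → ∀ m, m < n →
      gOfRecord₁₃ F N (theta13OfThm1CCM F N j ε₀ ε₂₉ B₃ B₃' a₀ a₁) p m ≤ gOfRecord₁₃ F N (theta13OfThm1CCM F N j ε₀ ε₂₉ B₃ B₃' a₀ a₁) p (m + 1))
    (hcompRev : ∀ (p : B12.RunParams) (n : ℕ), n ≤ p.K → Step.InInterval (theta13OfThm1CCM F N j ε₀ ε₂₉ B₃ B₃' a₀ a₁).γ n (gOfRecord₁₃ F N (theta13OfThm1CCM F N j ε₀ ε₂₉ B₃ B₃' a₀ a₁) p) → ∀ m, m < n →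
      (theta13OfThm1CCM F N j ε₀ ε₂₉ B₃ B₃' a₀ a₁).s2.cR * epsOfRecord (theta13OfThm1CCM F N j ε₀ ε₂₉ B₃ B₃' a₀ a₁).ν (gOfRecord₁₃ F N (theta13OfThm1CCM F N j ε₀ ε₂₉ B₃ B₃' a₀ a₁) p) (m + 1) ≤ 2 * ((theta13OfThm1CCM F N j ε₀ ε₂₉ B₃ B₃' a₀ a₁).s2.cR * epsOfRecord (theta13OfThm1CCM F N j ε₀ ε₂₉ B₃ B₃' a₀ a₁).ν (gOfRecord₁₃ F N (theta13OfThm1CCM F N j ε₀ ε₂₉ B₃ B₃' a₀ a₁) p) m)) :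
    ∀ (p : B12.RunParams) (n : ℕ), n ≤ p.K → Step.InInterval (theta13OfThm1CCM F N j ε₀ ε₂₉ B₃ B₃' a₀ a₁).γ n (gOfRecord₁₃ F N (theta13OfThm1CCM F N j ε₀ ε₂₉ B₃ B₃' a₀ a₁) p) → PartCompat₁₃ F N (theta13OfThm1CCM F N j ε₀ ε₂₉ B₃ B₃' a₀ a₁) p n →
      ∀ s : SeqOfRecord F (theta13OfThm1CCM F N j ε₀ ε₂₉ B₃ B₃' a₀ a₁).ν (theta13OfThm1CCM F N j ε₀ ε₂₉ B₃ B₃' a₀ a₁).τ9.M (gOfRecord₁₃ F N (theta13OfThm1CCM F N j ε₀ ε₂₉ B₃ B₃' a₀ a₁) p) p.K n, Sect2.SeqSeparated (theta13OfThm1CCM F N j ε₀ ε₂₉ B₃ B₃' a₀ a₁).ν.M₁ s →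
      ∀ W : MSField (F.P p.K) (SU N), W ∈ suppOfRecord₁₃P F N (theta13OfThm1CCM F N j ε₀ ε₂₉ B₃ B₃' a₀ a₁) p n s →
      Sect2.DataSmall7PTop (avOfRecord F N p.K) s.Ω (suppDomOfRecord F (theta13OfThm1CCM F N j ε₀ ε₂₉ B₃ B₃' a₀ a₁).ν p.K s.Ω) n (fun j' => (theta13OfThm1CCM F N j ε₀ ε₂₉ B₃ B₃' a₀ a₁).s2.cR * epsOfRecord (theta13OfThm1CCM F N j ε₀ ε₂₉ B₃ B₃' a₀ a₁).ν (gOfRecord₁₃ F N (theta13OfThm1CCM F N j ε₀ ε₂₉ B₃ B₃' a₀ a₁) p) j') W →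
      ∀ j', 1 ≤ j' → j' ≤ n → ∀ X : (Sect2.domSys (F.P p.K) (theta13OfThm1CCM F N j ε₀ ε₂₉ B₃ B₃' a₀ a₁).τ9.M j').Dom,
      (Sect2.domSites (F.P p.K) (theta13OfThm1CCM F N j ε₀ ε₂₉ B₃ B₃' a₀ a₁).τ9.M j' X ⊆ s.Λ j' →
        Sect2.ofBackgroundC (settingOfRecord₁₃ F N (theta13OfThm1CCM F N j ε₀ ε₂₉ B₃ B₃' a₀ a₁) p).ι (UbgOfRecord₁₃CoP F N (theta13OfThm1CCM F N j ε₀ ε₂₉ B₃ B₃' a₀ a₁) p n s W) ∈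
          Sect2.spaceI (settingOfRecord₁₃ F N (theta13OfThm1CCM F N j ε₀ ε₂₉ B₃ B₃' a₀ a₁) p) ((theta13OfThm1CCM F N j ε₀ ε₂₉ B₃ B₃' a₀ a₁).Rz p.K) (theta13OfThm1CCM F N j ε₀ ε₂₉ B₃ B₃' a₀ a₁).τ9.M j' (Sect2.domSites (F.P p.K) (theta13OfThm1CCM F N j ε₀ ε₂₉ B₃ B₃' a₀ a₁).τ9.M j' X)
            ((settingOfRecord₁₃ F N (theta13OfThm1CCM F N j ε₀ ε₂₉ B₃ B₃' a₀ a₁) p).lf.alpha0 ((settingOfRecord₁₃ F N (theta13OfThm1CCM F N j ε₀ ε₂₉ B₃ B₃' a₀ a₁) p).flow.g j')) ((settingOfRecord₁₃ F N (theta13OfThm1CCM F N j ε₀ ε₂₉ B₃ B₃' a₀ a₁) p).lf.alpha1 ((settingOfRecord₁₃ F N (theta13OfThm1CCM F N j ε₀ ε₂₉ B₃ B₃' a₀ a₁) p).flow.g j'))) ∧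
      (Sect2.admB (F.P p.K) (theta13OfThm1CCM F N j ε₀ ε₂₉ B₃ B₃' a₀ a₁).ν (theta13OfThm1CCM F N j ε₀ ε₂₉ B₃ B₃' a₀ a₁).τ9.M (gOfRecord₁₃ F N (theta13OfThm1CCM F N j ε₀ ε₂₉ B₃ B₃' a₀ a₁) p) s.Ω s.Λ j' (Sect2.domSites (F.P p.K) (theta13OfThm1CCM F N j ε₀ ε₂₉ B₃ B₃' a₀ a₁).τ9.M j' X) = true →
        Sect2.ofBackgroundC (settingOfRecord₁₃ F N (theta13OfThm1CCM F N j ε₀ ε₂₉ B₃ B₃' a₀ a₁) p).ι (UbgOfRecord₁₃CoP F N (theta13OfThm1CCM F N j ε₀ ε₂₉ B₃ B₃' a₀ a₁) p n s W) ∈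
          Sect2.spaceMS (settingOfRecord₁₃ F N (theta13OfThm1CCM F N j ε₀ ε₂₉ B₃ B₃' a₀ a₁) p) ((theta13OfThm1CCM F N j ε₀ ε₂₉ B₃ B₃' a₀ a₁).Rz p.K) (theta13OfThm1CCM F N j ε₀ ε₂₉ B₃ B₃' a₀ a₁).τ9.M j' (Sect2.domSites (F.P p.K) (theta13OfThm1CCM F N j ε₀ ε₂₉ B₃ B₃' a₀ a₁).τ9.M j' X) s.Ω) := by
  intro p n hn hw hpc s hsep W _ h7
  cases n with
  | zero => intro j' h1 hj'; exfalso; omega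
  | succ n =>
    rw [UbgOfRecord₁₃CoP_succ]
    exact (theta13OfThm1CCM F N j ε₀ ε₂₉ B₃ B₃' a₀ a₁).bgAtDatumBg_of_thm1RegSepCoP7MGB_of_thm1GaugeGB (admissible_theta13OfThm1CCM F N hε hε' hB hB' ha₀ ha₁) rfl
      (τ9_M_pos_theta13OfThm1CCM F N j ε₀ ε₂₉ B₃ B₃' a₀ a₁) h15 h15G
      (fun p n s W => UbgMSCoPOfRecordB F N (theta13OfThm1CCM F N j ε₀ ε₂₉ B₃ B₃' a₀ a₁).ν (theta13OfThm1CCM F N j ε₀ ε₂₉ B₃ B₃' a₀ a₁).τ9.M (gOfRecord₁₃ F N (theta13OfThm1CCM F N j ε₀ ε₂₉ B₃ B₃' a₀ a₁) p) p.K n s W)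
      (fun p n s W => ubgMSCoPOfRecordB_dichotomy (theta13OfThm1CCM F N j ε₀ ε₂₉ B₃ B₃' a₀ a₁).ν (theta13OfThm1CCM F N j ε₀ ε₂₉ B₃ B₃' a₀ a₁).τ9.M (gOfRecord₁₃ F N (theta13OfThm1CCM F N j ε₀ ε₂₉ B₃ B₃' a₀ a₁) p) p.K n s W)
      (hnum_theta13OfThm1CCM hB hB' ha₀ ha₁) εreg_le_theta13OfThm1CCM
      (hcomp_theta13OfThm1CCM_of_monotone hB hB' ha₀.le ha₁.le hmono) hcompRev (hBα_theta13OfThm1CCM hB hB' ha₀.le ha₁.le)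
      (htI_theta13OfThm1CCM hB hB' ha₀.le ha₁.le) (htMS_theta13OfThm1CCM hB hB' ha₀.le ha₁.le) hC1_theta13OfThm1CCM (hsN_theta13OfThm1CCM F N ε₀ ε₂₉ B₃ B₃' a₀ a₁ hjm)
      p (n + 1) hn hw hpc s hsep (M₁_pos_theta13OfThm1CCM F N j ε₀ ε₂₉ B₃ B₃' a₀ a₁) (show c ≤ (theta13OfThm1CCM F N j ε₀ ε₂₉ B₃ B₃' a₀ a₁).ν.M₁ by rw [theta13OfThm1CCM_M₁]; exact hc) W h7

/-- **★★ THE v1.5 PROVISOS OF RECORD AT `θ₁₅ᶜᶜᴹ(j)`** from the signs, (8), the R gauge sentence and the two history clauses, under `j + 1 ≤ F.m` (16a's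
`provisos₁₃SepCoP_theta13LiveOfNumerics_of_bgSepCoP` ∘ ★★★; pins `M = L^j`, `M₁ = L^j ∣ M`). [cite: Balaban1985Variational, (6)–(7) p.278, Thm 1 (8)–(9) p.279, (152) p.301, Prop. 8 p.304; Balaban1985RegularSpaces, (1.3)–(1.9) p.77; Balaban1988Convergent, Thm 1 p.262, (2.4)–(2.8) pp.255–256, (2.12)–(2.13) p.256, (2.18) p.257, (2.27)–(2.28) p.259, (2.34)–(2.41) p.261, (3.16)–(3.22) pp.268–269; Balaban1987RG1, (1.11)–(1.12) p.262; Balaban1989LargeFieldI, (0.3)–(0.4) p.176] -/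
theorem provisos₁₃SepCoP_theta13OfThm1CCM_of_thm1GaugeR (hjm : j + 1 ≤ F.m) (hε : 0 < ε₀) (hε' : 0 < ε₂₉) (hB : 0 ≤ B₃) (hB' : 0 ≤ B₃') (ha₀ : 0 < a₀) (ha₁ : 0 < a₁)
    (h15 : VariationalThm1RegSepCoP7MGB F N (floorGuard F c) (lamDatum F) (dataSmall7PTopOf F N) B₃ a₀ a₁) (hc : c ≤ F.L ^ j) (h15G : VariationalThm1GaugeRegSepCoP7MGB F N (F.L ^ j) (floorGuard F c) (lamDatum F) (dataSmall7PTopOf F N) B₃ B₃' a₀ a₁)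
    (hmono : ∀ (p : B12.RunParams) (n : ℕ), n ≤ p.K → Step.InInterval (theta13OfThm1CCM F N j ε₀ ε₂₉ B₃ B₃' a₀ a₁).γ n (gOfRecord₁₃ F N (theta13OfThm1CCM F N j ε₀ ε₂₉ B₃ B₃' a₀ a₁) p) → ∀ m, m < n →
      gOfRecord₁₃ F N (theta13OfThm1CCM F N j ε₀ ε₂₉ B₃ B₃' a₀ a₁) p m ≤ gOfRecord₁₃ F N (theta13OfThm1CCM F N j ε₀ ε₂₉ B₃ B₃' a₀ a₁) p (m + 1))
    (hcompRev : ∀ (p : B12.RunParams) (n : ℕ), n ≤ p.K → Step.InInterval (theta13OfThm1CCM F N j ε₀ ε₂₉ B₃ B₃' a₀ a₁).γ n (gOfRecord₁₃ F N (theta13OfThm1CCM F N j ε₀ ε₂₉ B₃ B₃' a₀ a₁) p) → ∀ m, m < n →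
      (theta13OfThm1CCM F N j ε₀ ε₂₉ B₃ B₃' a₀ a₁).s2.cR * epsOfRecord (theta13OfThm1CCM F N j ε₀ ε₂₉ B₃ B₃' a₀ a₁).ν (gOfRecord₁₃ F N (theta13OfThm1CCM F N j ε₀ ε₂₉ B₃ B₃' a₀ a₁) p) (m + 1) ≤ 2 * ((theta13OfThm1CCM F N j ε₀ ε₂₉ B₃ B₃' a₀ a₁).s2.cR * epsOfRecord (theta13OfThm1CCM F N j ε₀ ε₂₉ B₃ B₃' a₀ a₁).ν (gOfRecord₁₃ F N (theta13OfThm1CCM F N j ε₀ ε₂₉ B₃ B₃' a₀ a₁) p) m)) :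
    (theta13OfThm1CCM F N j ε₀ ε₂₉ B₃ B₃' a₀ a₁).Provisos₁₃SepCoP F N :=
  provisos₁₃SepCoP_theta13LiveOfNumerics_of_bgSepCoP F N (stage12NumericsOfThm1CCM F.L j ε₀ B₃ B₃' a₀ a₁) ε₂₉ ⟨j, rfl⟩ (dvd_refl _)
    (bgSepCoPAt_theta13OfThm1CCM_of_thm1GaugeR hjm hε hε' hB hB' ha₀ ha₁ h15 hc h15G hmono hcompRev)

end AtWitnessGaugeR

/-! ## §2. Closers: the ⁵ ∕ ⁶ ∕ ⁷ K0 bodies for `F` at `N = 2` at the collared witness from (8), the R gauge sentence ∕ the R step fact, and the β-box -/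

section ClosersGaugeR

variable {j c : ℕ} {ε₀ ε₂₉ B₃ B₃' a₀ a₁ : ℝ}

/-- **THE GENERIC ⁶ → ⁷ LIFT** (node00-def-T's history-blind door `Stage13HParams.ofHistoryBlind`: v1.6 provisos give v1.7 provisos, `ZrUnity` gives `ZhUnity`, row P12 and admissibility are
read through `toStage13RParams`) — the K-text bridge «⁷-inhabited ⇐ ⁶-inhabited» at the body level (plan's `Record13SepCoPHInhabited_of`, vet W.lean `record13SepCoPHInhabited_of_sepCoPR`).
[cite: Balaban1988Convergent, (2.21) p.258, (3.16)–(3.20) pp.268–269, (3.23) p.270; Balaban1989LargeFieldI, (0.2)–(0.4) p.176 (bookkeeping)] -/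
theorem exists_k0SepCoPH_of_exists_k0SepCoPR {F : T4Family} {N : ℕ} [NeZero N]
    (h : ∃ θ : Stage13RParams F N, θ.Provisos₁₃SepCoPR F N ∧ (θ.ZrUnity F N ∧ θ.SlotsNondegenerate₁₃ F N) ∧ θ.Admissible F N) :
    ∃ θ : Stage13HParams F N, θ.Provisos₁₃SepCoPH F N ∧ (θ.ZhUnity F N ∧ θ.SlotsNondegenerate₁₃ F N) ∧ θ.Admissible F N := by
  obtain ⟨θ, hP, ⟨hU, hS⟩, hA⟩ := h
  exact ⟨Stage13HParams.ofHistoryBlind F N θ, hP.ofHistoryBlind, ⟨hU.ofHistoryBlind, hS⟩, hA⟩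

/-- **★★★★★ THE v1.5 K0 BODY FOR `F` AT `N = 2` AT THE COLLARED WITNESS FROM (8) `VariationalThm1RegSepCoP7MGB F 2 (floorGuard F c) (lamDatum F) (dataSmall7PTopOf F 2) B₃ a₀ a₁` AND THE R GAUGE SENTENCE `VariationalThm1GaugeRegSepCoP7MGB F 2 (F.L ^ j) (floorGuard F c) (lamDatum F) (dataSmall7PTopOf F 2) B₃ B₃' a₀ a₁`
(`c ≤ F.L ^ j`) AND THE TWO HISTORY CLAUSES**, under `j + 1 ≤ F.m`: 16a's socket ∘ §1.  CONDITIONAL — nothing of Bałaban asserted; K0 NOT closed here. [cite: Balaban1985Variational, (6)–(7) p.278, Thm 1 (8)–(9) p.279, (152) p.301, Prop. 8 p.304; Balaban1985RegularSpaces, (1.3)–(1.9) p.77, Prop. 6 p.99; Balaban1988Convergent, Thm 1 p.262, (2.4)–(2.8) pp.255–256, (2.12)–(2.13) p.256, (2.27)–(2.28) p.259, (2.34)–(2.41) p.261, (3.16)–(3.22) pp.268–269; Balaban1987RG1, (1.11)–(1.12) p.262; Balaban1989LargeFieldI, (0.3)–(0.4) p.176] -/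
theorem exists_k0SepCoP_of_thm1RegSepCoP7M_of_thm1GaugeR (F : T4Family) (hjm : j + 1 ≤ F.m) (hε : 0 < ε₀) (hε' : 0 < ε₂₉) (hB : 0 ≤ B₃) (hB' : 0 ≤ B₃') (ha₀ : 0 < a₀) (ha₁ : 0 < a₁)
    (h15 : VariationalThm1RegSepCoP7MGB F 2 (floorGuard F c) (lamDatum F) (dataSmall7PTopOf F 2) B₃ a₀ a₁) (hc : c ≤ F.L ^ j) (h15G : VariationalThm1GaugeRegSepCoP7MGB F 2 (F.L ^ j) (floorGuard F c) (lamDatum F) (dataSmall7PTopOf F 2) B₃ B₃' a₀ a₁)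
    (hmono : ∀ (p : B12.RunParams) (n : ℕ), n ≤ p.K → Step.InInterval (theta13OfThm1CCM F 2 j ε₀ ε₂₉ B₃ B₃' a₀ a₁).γ n (gOfRecord₁₃ F 2 (theta13OfThm1CCM F 2 j ε₀ ε₂₉ B₃ B₃' a₀ a₁) p) → ∀ m, m < n →
      gOfRecord₁₃ F 2 (theta13OfThm1CCM F 2 j ε₀ ε₂₉ B₃ B₃' a₀ a₁) p m ≤ gOfRecord₁₃ F 2 (theta13OfThm1CCM F 2 j ε₀ ε₂₉ B₃ B₃' a₀ a₁) p (m + 1))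
    (hcompRev : ∀ (p : B12.RunParams) (n : ℕ), n ≤ p.K → Step.InInterval (theta13OfThm1CCM F 2 j ε₀ ε₂₉ B₃ B₃' a₀ a₁).γ n (gOfRecord₁₃ F 2 (theta13OfThm1CCM F 2 j ε₀ ε₂₉ B₃ B₃' a₀ a₁) p) → ∀ m, m < n →
      (theta13OfThm1CCM F 2 j ε₀ ε₂₉ B₃ B₃' a₀ a₁).s2.cR * epsOfRecord (theta13OfThm1CCM F 2 j ε₀ ε₂₉ B₃ B₃' a₀ a₁).ν (gOfRecord₁₃ F 2 (theta13OfThm1CCM F 2 j ε₀ ε₂₉ B₃ B₃' a₀ a₁) p) (m + 1) ≤ 2 * ((theta13OfThm1CCM F 2 j ε₀ ε₂₉ B₃ B₃' a₀ a₁).s2.cR * epsOfRecord (theta13OfThm1CCM F 2 j ε₀ ε₂₉ B₃ B₃' a₀ a₁).ν (gOfRecord₁₃ F 2 (theta13OfThm1CCM F 2 j ε₀ ε₂₉ B₃ B₃' a₀ a₁) p) m)) :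
    ∃ θ : Stage13Params F 2, θ.Provisos₁₃SepCoP F 2 ∧ (θ.ZtUnity F 2 ∧ θ.SlotsNondegenerate₁₃ F 2) ∧ θ.Admissible F 2 :=
  exists_k0SepCoP_of_bgSepCoP_theta13LiveOfNumerics F (stage12NumericsOfThm1CCM_pos (L := F.L) (j := j) F.hL.2.le hε hB hB' ha₀ ha₁) hε' ⟨j, rfl⟩ (dvd_refl _)
    (bgSepCoPAt_theta13OfThm1CCM_of_thm1GaugeR hjm hε hε' hB hB' ha₀ ha₁ h15 hc h15G hmono hcompRev)

/-- **★★★★★★ THE v1.5 K0 BODY FOR `F` AT THE COLLARED WITNESS FROM (8), THE R GAUGE SENTENCE AND THE β-BOX LEAF** (history clauses by A2 §5 `hmono_theta13OfThm1CCM_of_betaLowerH` and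
`hcompRev_theta13OfThm1CCM_of_betaBox`), under `j + 1 ≤ F.m`.  CONDITIONAL. [cite: Balaban1985Variational, (6)–(7) p.278, Thm 1 (8)–(9) p.279, (152) p.301, Prop. 8 p.304; Balaban1985RegularSpaces, (1.3)–(1.9) p.77; Balaban1988Convergent, Thm 1 p.262, (2.4)–(2.8) pp.255–256, (2.12)–(2.13) p.256, (2.27)–(2.28) p.259, (2.34)–(2.41) p.261, (3.16)–(3.22) pp.268–269; Balaban1987RG1, (0.20) p.256, (1.11)–(1.12) p.262, §1 p.264; Balaban1989LargeFieldI, (0.3)–(0.4) p.176] -/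
theorem exists_k0SepCoP_of_thm1RegSepCoP7M_of_thm1GaugeR_of_betaBox (F : T4Family) (hjm : j + 1 ≤ F.m) (hε : 0 < ε₀) (hε' : 0 < ε₂₉) (hB : 0 ≤ B₃) (hB' : 0 ≤ B₃') (ha₀ : 0 < a₀)
    (ha₁ : 0 < a₁) (h15 : VariationalThm1RegSepCoP7MGB F 2 (floorGuard F c) (lamDatum F) (dataSmall7PTopOf F 2) B₃ a₀ a₁) (hc : c ≤ F.L ^ j) (h15G : VariationalThm1GaugeRegSepCoP7MGB F 2 (F.L ^ j) (floorGuard F c) (lamDatum F) (dataSmall7PTopOf F 2) B₃ B₃' a₀ a₁)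
    {b β' : ℝ} (hb : 0 ≤ b) (hlow : FlowStep.BetaLowerH b (1 / 2) (betaOfRecord₁₃ F 2 (theta13OfThm1CCM F 2 j ε₀ ε₂₉ B₃ B₃' a₀ a₁)))
    (hup : FlowStep.BetaUpperH β' (1 / 2) (betaOfRecord₁₃ F 2 (theta13OfThm1CCM F 2 j ε₀ ε₂₉ B₃ B₃' a₀ a₁))) (hβ' : β' ≤ 3) :
    ∃ θ : Stage13Params F 2, θ.Provisos₁₃SepCoP F 2 ∧ (θ.ZtUnity F 2 ∧ θ.SlotsNondegenerate₁₃ F 2) ∧ θ.Admissible F 2 :=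
  exists_k0SepCoP_of_thm1RegSepCoP7M_of_thm1GaugeR F hjm hε hε' hB hB' ha₀ ha₁ h15 hc h15G (hmono_theta13OfThm1CCM_of_betaLowerH hb hlow)
    (hcompRev_theta13OfThm1CCM_of_betaBox hB hB' ha₀.le ha₁.le hb hlow hup hβ')

/-- **★★★★★★★ CUT B‴ (R) KEYED ON dag-n07-e's FLOOR-CARRYING STEP FACT**: the v1.5 K0 body for `F` at the collared witness from (8) `VariationalThm1RegSepCoP7MGB F 2 (floorGuard F c) (lamDatum F) (dataSmall7PTopOf F 2) B₃ a₀ a₁`, [15] Sect. F's (9)-step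
`Gauge9RegSepTopStepGB F 2 suppDom (F.L ^ j) (floorGuard F c) (lamDatum F) (dataSmall7PTopOf F 2) B₃ B₃' a₀ a₁` (`c ≤ F.L ^ j`; `Record12BgRowCoClassGaugeRGuardedB` §3: minimal ⇒ critical on the `lamDatum`-fibre), the β-box leaf at `θ₁₅ᶜᶜᴹ(j)` and the signs, under `j + 1 ≤ F.m`.  CONDITIONAL —
both facts are hypotheses. [cite: Balaban1985Variational, (6)–(7) p.278, Thm 1 (8)–(9) p.279, (144)–(152) pp.300–301, Prop. 8 p.304; Balaban1985RegularSpaces, (1.3)–(1.9) p.77, Prop. 6 p.99; Balaban1988Convergent, Thm 1 p.262, (2.4)–(2.8) pp.255–256, (2.12)–(2.13) p.256, (2.27)–(2.28) p.259, (2.34)–(2.41) p.261, (3.16)–(3.22) pp.268–269; Balaban1987RG1, (0.1) p.251, (0.20) p.256, (1.11)–(1.12) p.262; Balaban1989LargeFieldI, (0.3)–(0.4) p.176] -/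
theorem exists_k0SepCoP_of_thm1RegSepCoP7M_of_gauge9TopStepR_of_betaBox (F : T4Family) (hjm : j + 1 ≤ F.m) (hε : 0 < ε₀) (hε' : 0 < ε₂₉) (hB : 0 ≤ B₃) (hB' : 0 ≤ B₃') (ha₀ : 0 < a₀)
    (ha₁ : 0 < a₁) (h15 : VariationalThm1RegSepCoP7MGB F 2 (floorGuard F c) (lamDatum F) (dataSmall7PTopOf F 2) B₃ a₀ a₁) (hc : c ≤ F.L ^ j)
    (h9 : Gauge9RegSepTopStepGB F 2 (fun ν K Ω => suppDomOfRecord F ν K Ω) (F.L ^ j) (floorGuard F c) (lamDatum F) (dataSmall7PTopOf F 2) B₃ B₃' a₀ a₁)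
    {b β' : ℝ} (hb : 0 ≤ b) (hlow : FlowStep.BetaLowerH b (1 / 2) (betaOfRecord₁₃ F 2 (theta13OfThm1CCM F 2 j ε₀ ε₂₉ B₃ B₃' a₀ a₁)))
    (hup : FlowStep.BetaUpperH β' (1 / 2) (betaOfRecord₁₃ F 2 (theta13OfThm1CCM F 2 j ε₀ ε₂₉ B₃ B₃' a₀ a₁))) (hβ' : β' ≤ 3) :
    ∃ θ : Stage13Params F 2, θ.Provisos₁₃SepCoP F 2 ∧ (θ.ZtUnity F 2 ∧ θ.SlotsNondegenerate₁₃ F 2) ∧ θ.Admissible F 2 :=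
  exists_k0SepCoP_of_thm1RegSepCoP7M_of_thm1GaugeR_of_betaBox F hjm hε hε' hB hB' ha₀ ha₁ h15 hc (variationalThm1GaugeRegSepCoP7MGB_of_gauge9TopStepGB h9) hb hlow hup hβ'

/-- **THE ⁶ IMAGE OF ★★★★★** (FILE 18's cured lift `exists_k0SepCoPR_of_exists_k0SepCoP`). [cite: Balaban1985Variational, Thm 1 (8)–(9) p.279, Prop. 8 p.304; Balaban1988Convergent, Thm 1 p.262, (2.12)–(2.13) p.256, (2.27)–(2.28) p.259, (3.16)–(3.22) pp.268–269; Balaban1989LargeFieldI, (0.3)–(0.4) p.176] -/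
theorem exists_k0SepCoPR_of_thm1RegSepCoP7M_of_thm1GaugeR (F : T4Family) (hjm : j + 1 ≤ F.m) (hε : 0 < ε₀) (hε' : 0 < ε₂₉) (hB : 0 ≤ B₃) (hB' : 0 ≤ B₃') (ha₀ : 0 < a₀) (ha₁ : 0 < a₁)
    (h15 : VariationalThm1RegSepCoP7MGB F 2 (floorGuard F c) (lamDatum F) (dataSmall7PTopOf F 2) B₃ a₀ a₁) (hc : c ≤ F.L ^ j) (h15G : VariationalThm1GaugeRegSepCoP7MGB F 2 (F.L ^ j) (floorGuard F c) (lamDatum F) (dataSmall7PTopOf F 2) B₃ B₃' a₀ a₁)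
    (hmono : ∀ (p : B12.RunParams) (n : ℕ), n ≤ p.K → Step.InInterval (theta13OfThm1CCM F 2 j ε₀ ε₂₉ B₃ B₃' a₀ a₁).γ n (gOfRecord₁₃ F 2 (theta13OfThm1CCM F 2 j ε₀ ε₂₉ B₃ B₃' a₀ a₁) p) → ∀ m, m < n →
      gOfRecord₁₃ F 2 (theta13OfThm1CCM F 2 j ε₀ ε₂₉ B₃ B₃' a₀ a₁) p m ≤ gOfRecord₁₃ F 2 (theta13OfThm1CCM F 2 j ε₀ ε₂₉ B₃ B₃' a₀ a₁) p (m + 1))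
    (hcompRev : ∀ (p : B12.RunParams) (n : ℕ), n ≤ p.K → Step.InInterval (theta13OfThm1CCM F 2 j ε₀ ε₂₉ B₃ B₃' a₀ a₁).γ n (gOfRecord₁₃ F 2 (theta13OfThm1CCM F 2 j ε₀ ε₂₉ B₃ B₃' a₀ a₁) p) → ∀ m, m < n →
      (theta13OfThm1CCM F 2 j ε₀ ε₂₉ B₃ B₃' a₀ a₁).s2.cR * epsOfRecord (theta13OfThm1CCM F 2 j ε₀ ε₂₉ B₃ B₃' a₀ a₁).ν (gOfRecord₁₃ F 2 (theta13OfThm1CCM F 2 j ε₀ ε₂₉ B₃ B₃' a₀ a₁) p) (m + 1) ≤ 2 * ((theta13OfThm1CCM F 2 j ε₀ ε₂₉ B₃ B₃' a₀ a₁).s2.cR * epsOfRecord (theta13OfThm1CCM F 2 j ε₀ ε₂₉ B₃ B₃' a₀ a₁).ν (gOfRecord₁₃ F 2 (theta13OfThm1CCM F 2 j ε₀ ε₂₉ B₃ B₃' a₀ a₁) p) m)) :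
    ∃ θ : Stage13RParams F 2, θ.Provisos₁₃SepCoPR F 2 ∧ (θ.ZrUnity F 2 ∧ θ.SlotsNondegenerate₁₃ F 2) ∧ θ.Admissible F 2 :=
  exists_k0SepCoPR_of_exists_k0SepCoP F (exists_k0SepCoP_of_thm1RegSepCoP7M_of_thm1GaugeR F hjm hε hε' hB hB' ha₀ ha₁ h15 hc h15G hmono hcompRev)

/-- **THE ⁶ IMAGE OF ★★★★★★** (β-box form). [cite: Balaban1985Variational, Thm 1 (8)–(9) p.279, Prop. 8 p.304; Balaban1988Convergent, Thm 1 p.262, (2.6)–(2.8) pp.255–256, (2.12)–(2.13) p.256, (3.16)–(3.22) pp.268–269; Balaban1987RG1, (0.20) p.256, §1 p.264; Balaban1989LargeFieldI, (0.3)–(0.4) p.176] -/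
theorem exists_k0SepCoPR_of_thm1RegSepCoP7M_of_thm1GaugeR_of_betaBox (F : T4Family) (hjm : j + 1 ≤ F.m) (hε : 0 < ε₀) (hε' : 0 < ε₂₉) (hB : 0 ≤ B₃) (hB' : 0 ≤ B₃') (ha₀ : 0 < a₀)
    (ha₁ : 0 < a₁) (h15 : VariationalThm1RegSepCoP7MGB F 2 (floorGuard F c) (lamDatum F) (dataSmall7PTopOf F 2) B₃ a₀ a₁) (hc : c ≤ F.L ^ j) (h15G : VariationalThm1GaugeRegSepCoP7MGB F 2 (F.L ^ j) (floorGuard F c) (lamDatum F) (dataSmall7PTopOf F 2) B₃ B₃' a₀ a₁)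
    {b β' : ℝ} (hb : 0 ≤ b) (hlow : FlowStep.BetaLowerH b (1 / 2) (betaOfRecord₁₃ F 2 (theta13OfThm1CCM F 2 j ε₀ ε₂₉ B₃ B₃' a₀ a₁)))
    (hup : FlowStep.BetaUpperH β' (1 / 2) (betaOfRecord₁₃ F 2 (theta13OfThm1CCM F 2 j ε₀ ε₂₉ B₃ B₃' a₀ a₁))) (hβ' : β' ≤ 3) :
    ∃ θ : Stage13RParams F 2, θ.Provisos₁₃SepCoPR F 2 ∧ (θ.ZrUnity F 2 ∧ θ.SlotsNondegenerate₁₃ F 2) ∧ θ.Admissible F 2 :=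
  exists_k0SepCoPR_of_exists_k0SepCoP F (exists_k0SepCoP_of_thm1RegSepCoP7M_of_thm1GaugeR_of_betaBox F hjm hε hε' hB hB' ha₀ ha₁ h15 hc h15G hb hlow hup hβ')

/-- **★★★★★★★ THE ⁶ K0 BODY KEYED ON THE R STEP FACT** — K0⁶ `Record13SepCoPRInhabited`'s body for `F` (`j + 1 ≤ F.m`) from (8) `VariationalThm1RegSepCoP7MGB F 2 (floorGuard F c) (lamDatum F) (dataSmall7PTopOf F 2) B₃ a₀ a₁`, dag-n07-e's
`Gauge9RegSepTopStepGB F 2 suppDom (F.L ^ j) (floorGuard F c) (lamDatum F) (dataSmall7PTopOf F 2) B₃ B₃' a₀ a₁` (`c ≤ F.L ^ j`), the β-box leaf at `θ₁₅ᶜᶜᴹ(j)` and the signs; cured witness.  The theorem plan g75's V14 stub 3 `K0ROfStepTokensRAt F` reads at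
`j = 3` for `4 ≤ F.m` (modulo the β-box).  CONDITIONAL — nothing of Bałaban asserted; K0⁶∕K0⁷ NOT closed here. [cite: Balaban1985Variational, (6)–(7) p.278, Thm 1 (8)–(9) p.279, (144)–(152) pp.300–301, Prop. 8 p.304; Balaban1985RegularSpaces, (1.3)–(1.9) p.77, Prop. 6 p.99; Balaban1988Convergent, Thm 1 p.262, (2.4)–(2.8) pp.255–256, (2.12)–(2.13) p.256, (2.27)–(2.28) p.259, (2.34)–(2.41) p.261, (3.16)–(3.22) pp.268–269; Balaban1987RG1, (0.1) p.251, (0.20) p.256, (1.11)–(1.12) p.262; Balaban1989LargeFieldI, (0.3)–(0.4) p.176] -/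
theorem exists_k0SepCoPR_of_thm1RegSepCoP7M_of_gauge9TopStepR_of_betaBox (F : T4Family) (hjm : j + 1 ≤ F.m) (hε : 0 < ε₀) (hε' : 0 < ε₂₉) (hB : 0 ≤ B₃) (hB' : 0 ≤ B₃') (ha₀ : 0 < a₀)
    (ha₁ : 0 < a₁) (h15 : VariationalThm1RegSepCoP7MGB F 2 (floorGuard F c) (lamDatum F) (dataSmall7PTopOf F 2) B₃ a₀ a₁) (hc : c ≤ F.L ^ j)
    (h9 : Gauge9RegSepTopStepGB F 2 (fun ν K Ω => suppDomOfRecord F ν K Ω) (F.L ^ j) (floorGuard F c) (lamDatum F) (dataSmall7PTopOf F 2) B₃ B₃' a₀ a₁)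
    {b β' : ℝ} (hb : 0 ≤ b) (hlow : FlowStep.BetaLowerH b (1 / 2) (betaOfRecord₁₃ F 2 (theta13OfThm1CCM F 2 j ε₀ ε₂₉ B₃ B₃' a₀ a₁)))
    (hup : FlowStep.BetaUpperH β' (1 / 2) (betaOfRecord₁₃ F 2 (theta13OfThm1CCM F 2 j ε₀ ε₂₉ B₃ B₃' a₀ a₁))) (hβ' : β' ≤ 3) :
    ∃ θ : Stage13RParams F 2, θ.Provisos₁₃SepCoPR F 2 ∧ (θ.ZrUnity F 2 ∧ θ.SlotsNondegenerate₁₃ F 2) ∧ θ.Admissible F 2 :=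
  exists_k0SepCoPR_of_exists_k0SepCoP F (exists_k0SepCoP_of_thm1RegSepCoP7M_of_gauge9TopStepR_of_betaBox F hjm hε hε' hB hB' ha₀ ha₁ h15 hc h9 hb hlow hup hβ')

/-- **THE ⁷ IMAGE OF ★★★★★★** — K0⁷ `Record13SepCoPHInhabited`'s body for `F` (`j + 1 ≤ F.m`) from (8), the R gauge sentence and the β-box (history-blind door). [cite: Balaban1985Variational, Thm 1 (8)–(9) p.279, Prop. 8 p.304; Balaban1988Convergent, Thm 1 p.262, (2.21) p.258, (3.16)–(3.23) pp.268–270; Balaban1989LargeFieldI, (0.2)–(0.4) p.176] -/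
theorem exists_k0SepCoPH_of_thm1RegSepCoP7M_of_thm1GaugeR_of_betaBox (F : T4Family) (hjm : j + 1 ≤ F.m) (hε : 0 < ε₀) (hε' : 0 < ε₂₉) (hB : 0 ≤ B₃) (hB' : 0 ≤ B₃') (ha₀ : 0 < a₀)
    (ha₁ : 0 < a₁) (h15 : VariationalThm1RegSepCoP7MGB F 2 (floorGuard F c) (lamDatum F) (dataSmall7PTopOf F 2) B₃ a₀ a₁) (hc : c ≤ F.L ^ j) (h15G : VariationalThm1GaugeRegSepCoP7MGB F 2 (F.L ^ j) (floorGuard F c) (lamDatum F) (dataSmall7PTopOf F 2) B₃ B₃' a₀ a₁)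
    {b β' : ℝ} (hb : 0 ≤ b) (hlow : FlowStep.BetaLowerH b (1 / 2) (betaOfRecord₁₃ F 2 (theta13OfThm1CCM F 2 j ε₀ ε₂₉ B₃ B₃' a₀ a₁)))
    (hup : FlowStep.BetaUpperH β' (1 / 2) (betaOfRecord₁₃ F 2 (theta13OfThm1CCM F 2 j ε₀ ε₂₉ B₃ B₃' a₀ a₁))) (hβ' : β' ≤ 3) :
    ∃ θ : Stage13HParams F 2, θ.Provisos₁₃SepCoPH F 2 ∧ (θ.ZhUnity F 2 ∧ θ.SlotsNondegenerate₁₃ F 2) ∧ θ.Admissible F 2 :=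
  exists_k0SepCoPH_of_exists_k0SepCoPR (exists_k0SepCoPR_of_thm1RegSepCoP7M_of_thm1GaugeR_of_betaBox F hjm hε hε' hB hB' ha₀ ha₁ h15 hc h15G hb hlow hup hβ')

/-- **★★★★★★★ THE ⁷ K0 BODY KEYED ON THE R STEP FACT** — K0⁷ `Record13SepCoPHInhabited`'s body for `F` (`j + 1 ≤ F.m`) from (8) `VariationalThm1RegSepCoP7MGB F 2 (floorGuard F c) (lamDatum F) (dataSmall7PTopOf F 2) B₃ a₀ a₁`, dag-n07-e's
`Gauge9RegSepTopStepGB F 2 suppDom (F.L ^ j) (floorGuard F c) (lamDatum F) (dataSmall7PTopOf F 2) B₃ B₃' a₀ a₁` (`c ≤ F.L ^ j`), the β-box leaf at `θ₁₅ᶜᶜᴹ(j)` and the signs (history-blind door ∘ cured lift ∘ ★★★★★★★).  With dag-n07-e's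
`variationalThm1RegSepCoP7MGB_of_prop8RegSepTopStepGB_of_zero` and `gauge9GB_of_prop8TopStepGB_of_gauge152R` ∘ `gauge152R_of_prop6` the K0⁷ closing term for `4 ≤ F.m` is one line over [15] Prop. 8's guarded top step, [6]
Prop. 6 at NODE 00's member, the β-box and the signs.  CONDITIONAL — nothing of Bałaban asserted; K0⁷ NOT closed here. [cite: Balaban1985Variational, (6)–(7) p.278, Thm 1 (8)–(9) p.279, (144)–(152) pp.300–301, Prop. 8 p.304; Balaban1985RegularSpaces, (1.3)–(1.9) p.77, Prop. 6 p.99; Balaban1988Convergent, Thm 1 p.262, (2.4)–(2.8) pp.255–256, (2.12)–(2.13) p.256, (2.21) p.258, (2.27)–(2.28) p.259, (2.34)–(2.41) p.261, (3.16)–(3.23) pp.268–270; Balaban1987RG1, (0.1) p.251, (0.20) p.256, (1.11)–(1.12) p.262; Balaban1989LargeFieldI, (0.2)–(0.4) p.176] -/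
theorem exists_k0SepCoPH_of_thm1RegSepCoP7M_of_gauge9TopStepR_of_betaBox (F : T4Family) (hjm : j + 1 ≤ F.m) (hε : 0 < ε₀) (hε' : 0 < ε₂₉) (hB : 0 ≤ B₃) (hB' : 0 ≤ B₃') (ha₀ : 0 < a₀)
    (ha₁ : 0 < a₁) (h15 : VariationalThm1RegSepCoP7MGB F 2 (floorGuard F c) (lamDatum F) (dataSmall7PTopOf F 2) B₃ a₀ a₁) (hc : c ≤ F.L ^ j)
    (h9 : Gauge9RegSepTopStepGB F 2 (fun ν K Ω => suppDomOfRecord F ν K Ω) (F.L ^ j) (floorGuard F c) (lamDatum F) (dataSmall7PTopOf F 2) B₃ B₃' a₀ a₁)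
    {b β' : ℝ} (hb : 0 ≤ b) (hlow : FlowStep.BetaLowerH b (1 / 2) (betaOfRecord₁₃ F 2 (theta13OfThm1CCM F 2 j ε₀ ε₂₉ B₃ B₃' a₀ a₁)))
    (hup : FlowStep.BetaUpperH β' (1 / 2) (betaOfRecord₁₃ F 2 (theta13OfThm1CCM F 2 j ε₀ ε₂₉ B₃ B₃' a₀ a₁))) (hβ' : β' ≤ 3) :
    ∃ θ : Stage13HParams F 2, θ.Provisos₁₃SepCoPH F 2 ∧ (θ.ZhUnity F 2 ∧ θ.SlotsNondegenerate₁₃ F 2) ∧ θ.Admissible F 2 :=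
  exists_k0SepCoPH_of_exists_k0SepCoPR (exists_k0SepCoPR_of_thm1RegSepCoP7M_of_gauge9TopStepR_of_betaBox F hjm hε hε' hB hB' ha₀ ha₁ h15 hc h9 hb hlow hup hβ')

/-- **★ THE V14-FACING INSTANCE** — at `j = 3`, cube letter `M = F.L ^ 3`, floor `c = (11·4 + 3·F.L)·F.L` (the `c` of `gauge152R_of_prop6`; `(44 + 3L)·L ≤ L³` for `L ≥ 13`), for families with
`4 ≤ F.m`: the ⁶ body from (8), the R step fact at `(L³, (44+3L)L)`, the β-box at `θ₁₅ᶜᶜᴹ(3)` and the signs — the `4 ≤ F.m` branch of plan g75's V14 stub 3 `K0ROfStepTokensRAt F`, modulo its β-box.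
CONDITIONAL. [cite: Balaban1985Variational, Thm 1 (8)–(9) p.279, (144)–(152) pp.300–301, Prop. 8 p.304; Balaban1985RegularSpaces, (1.3)–(1.6) p.77, Prop. 6 p.99, (1.130) p.99; Balaban1988Convergent, Thm 1 p.262, (2.12)–(2.13) p.256, (3.16)–(3.22) pp.268–269; Balaban1987RG1, (0.1) p.251; Balaban1989LargeFieldI, (0.3)–(0.4) p.176] -/
theorem exists_k0SepCoPR_of_thm1RegSepCoP7M_of_gauge9TopStepR_of_betaBox_cube (F : T4Family) (hm : 4 ≤ F.m) (hε : 0 < ε₀) (hε' : 0 < ε₂₉) (hB : 0 ≤ B₃) (hB' : 0 ≤ B₃') (ha₀ : 0 < a₀)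
    (ha₁ : 0 < a₁) (h15 : VariationalThm1RegSepCoP7MGB F 2 (floorGuard F ((11 * 4 + 3 * F.L) * F.L)) (lamDatum F) (dataSmall7PTopOf F 2) B₃ a₀ a₁)
    (h9 : Gauge9RegSepTopStepGB F 2 (fun ν K Ω => suppDomOfRecord F ν K Ω) (F.L ^ 3) (floorGuard F ((11 * 4 + 3 * F.L) * F.L)) (lamDatum F) (dataSmall7PTopOf F 2) B₃ B₃' a₀ a₁)
    {b β' : ℝ} (hb : 0 ≤ b) (hlow : FlowStep.BetaLowerH b (1 / 2) (betaOfRecord₁₃ F 2 (theta13OfThm1CCM F 2 3 ε₀ ε₂₉ B₃ B₃' a₀ a₁)))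
    (hup : FlowStep.BetaUpperH β' (1 / 2) (betaOfRecord₁₃ F 2 (theta13OfThm1CCM F 2 3 ε₀ ε₂₉ B₃ B₃' a₀ a₁))) (hβ' : β' ≤ 3) :
    ∃ θ : Stage13RParams F 2, θ.Provisos₁₃SepCoPR F 2 ∧ (θ.ZrUnity F 2 ∧ θ.SlotsNondegenerate₁₃ F 2) ∧ θ.Admissible F 2 :=
  exists_k0SepCoPR_of_thm1RegSepCoP7M_of_gauge9TopStepR_of_betaBox F (j := 3) hm hε hε' hB hB' ha₀ ha₁ h15
    ((theta13OfThm1CCM_M₁ F 2 3 ε₀ ε₂₉ B₃ B₃' a₀ a₁) ▸ collar_le_M₁_theta13OfThm1CCM F 2 ε₀ ε₂₉ B₃ B₃' a₀ a₁ (le_refl 3)) h9 hb hlow hup hβ'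

end ClosersGaugeR

end Literature.MathematicalPhysics.QuantumFieldTheory.Balaban1983to89.Node00

end
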